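import Mathlib
import Summits.Ventures.PercRepro2.TwoClusterBK

/-!
# Two-cluster three-point inequality (PercRepro2, mine-1)

The union-Reimer inequality with a decreasing restriction (`bk_union_decr_weighted`, MINE-1 16.7/16.8)
on `{x ↮ y}`, where disjoint occurrence of connections in the two clusters is plain intersection
(`dOcc_of_not_carries`): for a decreasing `D ⊆ {x ↮ y}` and vertices `a, c` (attached to `x`) and
`b, d` (attached to `y`),

  `P(x↔a, y↔b, D, {x↔c} ∪ {y↔d}) ≤ P(x↔a, x↔c, D)·P(y↔b) + P(x↔a, D)·P(y↔b, y↔d) − P(x↔a, x↔c, D)·P(y↔b, y↔d)`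

(`two_cluster_union_bk_prob`).  With `(x, y, a, b) = (a_l, a_h, o, b)`, `D = R = {a_l ↮ a_h, a_l ↮ a₃}`
and `d = a₃`, the event `{y ↔ d}` is the T-world `{a₃ ∈ C_h}` of the crux's bookkeeping.
-/

namespace Summit.Ventures.PercRepro2

open ReimerCube

section TwoClusterUnion

variable {V : Type*} {E : Type*} [Fintype E] [DecidableEq E]

open Classical in
/-- **Two-cluster three-point inequality** (weighted form on edge sets). -/
theorem two_cluster_union_bk (p : E → ℝ) (hp : IsProbVec p) (ends : E → Sym2 V) (x y a b c d : V)
    (D : Finset E → Prop) (hD : Decr D) (hDQ : ∀ S, D S → ¬ Carries ends S x y) :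
    (∑ S ∈ Finset.univ.powerset.filter (fun S => Carries ends S x a ∧ Carries ends S y b ∧
        (Carries ends S x c ∨ Carries ends S y d) ∧ D S), wt Finset.univ p S)
      ≤ (∑ S ∈ Finset.univ.powerset.filter
            (fun S => (Carries ends S x a ∧ Carries ends S x c) ∧ D S), wt Finset.univ p S)
          * (∑ S ∈ Finset.univ.powerset.filter (fun S => Carries ends S y b), wt Finset.univ p S)
        + (∑ S ∈ Finset.univ.powerset.filter (fun S => Carries ends S x a ∧ D S), wt Finset.univ p S)
          * (∑ S ∈ Finset.univ.powerset.filter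
              (fun S => Carries ends S y b ∧ Carries ends S y d), wt Finset.univ p S)
        - (∑ S ∈ Finset.univ.powerset.filter
            (fun S => (Carries ends S x a ∧ Carries ends S x c) ∧ D S), wt Finset.univ p S)
          * (∑ S ∈ Finset.univ.powerset.filter
              (fun S => Carries ends S y b ∧ Carries ends S y d), wt Finset.univ p S) := by
  have hp' : ∀ i, 0 ≤ p i ∧ p i ≤ 1 := fun i => ⟨hp.nonneg i, hp.le_one i⟩
  set E₁ : Finset E → Prop := fun S => Carries ends S x a ∧ Carries ends S x c with hE₁
  set E₂ : Finset E → Prop := fun S => Carries ends S x a with hE₂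
  set F₁ : Finset E → Prop := fun S => Carries ends S y b with hF₁
  set F₂ : Finset E → Prop := fun S => Carries ends S y b ∧ Carries ends S y d with hF₂
  have iE₁ : Incr E₁ := fun _ _ h hx => ⟨Carries.mono h hx.1, Carries.mono h hx.2⟩
  have iE₂ : Incr E₂ := incr_carries ends x a
  have iF₁ : Incr F₁ := incr_carries ends y b
  have iF₂ : Incr F₂ := fun _ _ h hx => ⟨Carries.mono h hx.1, Carries.mono h hx.2⟩
  have h := bk_union_decr_weighted Finset.univ p hp' E₁ E₂ F₁ F₂ D iE₁ iE₂ iF₁ iF₂ hD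
    (fun _ h => h.1) (fun _ h => h.1)
  rw [sum_wt, mul_one] at h
  -- the left side is dominated by the union-Reimer sum
  have hL : (∑ S ∈ Finset.univ.powerset.filter (fun S => Carries ends S x a ∧ Carries ends S y b ∧
        (Carries ends S x c ∨ Carries ends S y d) ∧ D S), wt Finset.univ p S)
      ≤ ∑ S ∈ Finset.univ.powerset.filter
          (fun S => (DOcc E₁ F₁ S ∨ DOcc E₂ F₂ S) ∧ D S), wt Finset.univ p S := by
    apply Finset.sum_le_sum_of_subset_of_nonneg
    · intro S hS
      rw [Finset.mem_filter] at hS ⊢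
      obtain ⟨hS1, hxa, hyb, hcd, hDS⟩ := hS
      refine ⟨hS1, ?_, hDS⟩
      have hne := hDQ S hDS
      rcases hcd with hxc | hyd
      · -- witnesses: the x-component (carries x–a and x–c) and the y-component (carries y–b)
        left
        refine ⟨sComp ends S x, sComp ends S y, sComp_subset ends S x, sComp_subset ends S y,
          disjoint_sComp_of_not_carries hne, ?_, ?_⟩
        · intro T hT
          exact ⟨Carries.mono hT (carries_sComp hxa), Carries.mono hT (carries_sComp hxc)⟩
        · intro T hT
          exact Carries.mono hT (carries_sComp hyb)
      · right
        refine ⟨sComp ends S x, sComp ends S y, sComp_subset ends S x, sComp_subset ends S y,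
          disjoint_sComp_of_not_carries hne, ?_, ?_⟩
        · intro T hT
          exact Carries.mono hT (carries_sComp hxa)
        · intro T hT
          exact ⟨Carries.mono hT (carries_sComp hyb), Carries.mono hT (carries_sComp hyd)⟩
    · intro S _ _
      exact wt_nonneg Finset.univ p hp' S
  -- inclusion–exclusion on the pair sets `(E₁∩D)×F₁ ∪ (E₂∩D)×F₂` with intersection `(E₁∩D)×F₂`
  set P₁ := Finset.univ.powerset.filter (fun S => E₁ S ∧ D S) ×ˢ Finset.univ.powerset.filter F₁ with hP₁
  set P₂ := Finset.univ.powerset.filter (fun S => E₂ S ∧ D S) ×ˢ Finset.univ.powerset.filter F₂ with hP₂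
  have hI : P₁ ∩ P₂ = Finset.univ.powerset.filter (fun S => E₁ S ∧ D S) ×ˢ
      Finset.univ.powerset.filter F₂ := by
    ext q
    simp only [hP₁, hP₂, Finset.mem_filter, Finset.mem_product, Finset.mem_inter, hE₁, hE₂, hF₁, hF₂]
    tauto
  have hie := Finset.sum_union_inter (s₁ := P₁) (s₂ := P₂)
    (f := fun q => wt Finset.univ p q.1 * wt Finset.univ p q.2)
  rw [hI] at hie
  have e1 : ∑ q ∈ P₁, wt Finset.univ p q.1 * wt Finset.univ p q.2
      = (∑ S ∈ Finset.univ.powerset.filter (fun S => E₁ S ∧ D S), wt Finset.univ p S)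
          * (∑ S ∈ Finset.univ.powerset.filter F₁, wt Finset.univ p S) := by
    rw [Finset.sum_mul_sum, hP₁, Finset.sum_product]
  have e2 : ∑ q ∈ P₂, wt Finset.univ p q.1 * wt Finset.univ p q.2
      = (∑ S ∈ Finset.univ.powerset.filter (fun S => E₂ S ∧ D S), wt Finset.univ p S)
          * (∑ S ∈ Finset.univ.powerset.filter F₂, wt Finset.univ p S) := by
    rw [Finset.sum_mul_sum, hP₂, Finset.sum_product]
  have e3 : ∑ q ∈ Finset.univ.powerset.filter (fun S => E₁ S ∧ D S) ×ˢ
        Finset.univ.powerset.filter F₂, wt Finset.univ p q.1 * wt Finset.univ p q.2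
      = (∑ S ∈ Finset.univ.powerset.filter (fun S => E₁ S ∧ D S), wt Finset.univ p S)
          * (∑ S ∈ Finset.univ.powerset.filter F₂, wt Finset.univ p S) := by
    rw [Finset.sum_mul_sum, Finset.sum_product]
  have key : (∑ S ∈ Finset.univ.powerset.filter
        (fun S => (DOcc E₁ F₁ S ∨ DOcc E₂ F₂ S) ∧ D S), wt Finset.univ p S)
      ≤ ∑ q ∈ P₁ ∪ P₂, wt Finset.univ p q.1 * wt Finset.univ p q.2 := by
    refine h.trans (le_of_eq ?_)
    apply Finset.sum_congr
    · ext q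
      simp only [hP₁, hP₂, Finset.mem_filter, Finset.mem_product, Finset.mem_union]
      tauto
    · intros; rfl
  have hfin : (∑ S ∈ Finset.univ.powerset.filter (fun S => Carries ends S x a ∧ Carries ends S y b ∧
        (Carries ends S x c ∨ Carries ends S y d) ∧ D S), wt Finset.univ p S)
      ≤ (∑ S ∈ Finset.univ.powerset.filter (fun S => E₁ S ∧ D S), wt Finset.univ p S)
          * (∑ S ∈ Finset.univ.powerset.filter F₁, wt Finset.univ p S)
        + (∑ S ∈ Finset.univ.powerset.filter (fun S => E₂ S ∧ D S), wt Finset.univ p S)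
          * (∑ S ∈ Finset.univ.powerset.filter F₂, wt Finset.univ p S)
        - (∑ S ∈ Finset.univ.powerset.filter (fun S => E₁ S ∧ D S), wt Finset.univ p S)
          * (∑ S ∈ Finset.univ.powerset.filter F₂, wt Finset.univ p S) := by
    linarith [hL, key, hie, e1, e2, e3]
  exact hfin

open Classical in
/-- **Two-cluster three-point inequality** in typer-1's `prob` vocabulary: for a decreasing event `D`
of configurations contained in `{x ↮ y}`,
`P(x↔a, y↔b, D, {x↔c} ∪ {y↔d}) ≤ P(x↔a, x↔c, D)·P(y↔b) + P(x↔a, D)·P(y↔b, y↔d) − P(x↔a, x↔c, D)·P(y↔b, y↔d)`. -/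
theorem two_cluster_union_bk_prob (p : E → ℝ) (hp : IsProbVec p) (ends : E → Sym2 V)
    (x y a b c d : V) (D : Set (Config E)) (hD : IsLowerSet D) (hDQ : ∀ ω ∈ D, ¬ Conn ends ω x y) :
    prob p (connEvent ends x a ∩ connEvent ends y b ∩ (connEvent ends x c ∪ connEvent ends y d) ∩ D)
      ≤ prob p (connEvent ends x a ∩ connEvent ends x c ∩ D) * prob p (connEvent ends y b)
        + prob p (connEvent ends x a ∩ D) * prob p (connEvent ends y b ∩ connEvent ends y d)
        - prob p (connEvent ends x a ∩ connEvent ends x c ∩ D)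
          * prob p (connEvent ends y b ∩ connEvent ends y d) := by
  have hDf : Decr (fun S : Finset E => ofFinset S ∈ D) := fun S T hST hT => hD (ofFinset_mono hST) hT
  have hDQf : ∀ S : Finset E, ofFinset S ∈ D → ¬ Carries ends S x y := fun S hS => hDQ _ hS
  have h := two_cluster_union_bk p hp ends x y a b c d (fun S => ofFinset S ∈ D) hDf hDQf
  rw [prob_eq_sum_wt, prob_eq_sum_wt, prob_eq_sum_wt, prob_eq_sum_wt, prob_eq_sum_wt]
  have e0 : (∑ S ∈ Finset.univ.powerset.filter (fun S => ofFinset S ∈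
        connEvent ends x a ∩ connEvent ends y b ∩ (connEvent ends x c ∪ connEvent ends y d) ∩ D),
        wt Finset.univ p S)
      = ∑ S ∈ Finset.univ.powerset.filter (fun S => Carries ends S x a ∧ Carries ends S y b ∧
          (Carries ends S x c ∨ Carries ends S y d) ∧ ofFinset S ∈ D), wt Finset.univ p S :=
    sum_filter_congr_pred fun _ =>
      ⟨fun ⟨⟨⟨h1, h2⟩, h3⟩, h4⟩ => ⟨h1, h2, h3, h4⟩, fun ⟨h1, h2, h3, h4⟩ => ⟨⟨⟨h1, h2⟩, h3⟩, h4⟩⟩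
  have e1 : (∑ S ∈ Finset.univ.powerset.filter (fun S => ofFinset S ∈
        connEvent ends x a ∩ connEvent ends x c ∩ D), wt Finset.univ p S)
      = ∑ S ∈ Finset.univ.powerset.filter
          (fun S => (Carries ends S x a ∧ Carries ends S x c) ∧ ofFinset S ∈ D), wt Finset.univ p S :=
    sum_filter_congr_pred fun _ => Iff.rfl
  have e2 : (∑ S ∈ Finset.univ.powerset.filter (fun S => ofFinset S ∈ connEvent ends y b),
        wt Finset.univ p S)
      = ∑ S ∈ Finset.univ.powerset.filter (fun S => Carries ends S y b), wt Finset.univ p S :=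
    sum_filter_congr_pred fun _ => Iff.rfl
  have e3 : (∑ S ∈ Finset.univ.powerset.filter (fun S => ofFinset S ∈ connEvent ends x a ∩ D),
        wt Finset.univ p S)
      = ∑ S ∈ Finset.univ.powerset.filter (fun S => Carries ends S x a ∧ ofFinset S ∈ D),
          wt Finset.univ p S :=
    sum_filter_congr_pred fun _ => Iff.rfl
  have e4 : (∑ S ∈ Finset.univ.powerset.filter (fun S => ofFinset S ∈
        connEvent ends y b ∩ connEvent ends y d), wt Finset.univ p S)
      = ∑ S ∈ Finset.univ.powerset.filter (fun S => Carries ends S y b ∧ Carries ends S y d),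
          wt Finset.univ p S :=
    sum_filter_congr_pred fun _ => Iff.rfl
  rw [e0, e1, e2, e3, e4]
  exact h

end TwoClusterUnion

end Summit.Ventures.PercRepro2
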